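import Literature.MathematicalPhysics.QuantumFieldTheory.Balaban1983to89.B11Eq44QuadLetter
import Literature.MathematicalPhysics.QuantumFieldTheory.Balaban1983to89.B9Eq315QTorus
import Literature.MathematicalPhysics.QuantumFieldTheory.Balaban1983to89.B7Prop7OneStep
import Literature.MathematicalPhysics.QuantumFieldTheory.Balaban1983to89.B11Eq45HOperator

/-!
# `Balaban1983to89.B11Eq44COperatorTorus` — T. Bałaban, *The variational problem and background fields in renormalization group method for
lattice gauge theories*, Commun. Math. Phys. **102** (1985) 277–309 [Balaban1985Variational], Sect. C p. 285 (44), (47)–(52), with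
[Balaban1985Averaging] (= [4]) Proposition 3 (121)–(123) p. 36 and Proposition 7 p. 43: **THE LETTER `C` OF (44)/(49)–(50) — THE NONLINEAR
PART OF THE ONE-STEP AVERAGING AT THE BACKGROUND `U` ON THE PERIODIC LATTICE — AS A MAP BETWEEN THE CARRIERS OF (115), WITH ITS
`QuadAnalytic` CLAUSE PROVED** from the NE7c crew's [4] Prop. 3/7 theorems (`B7Prop7OneStep`), in the one-level periodic model of the NE9 row
owner's `B9Eq315QTorus` (the SAME periodic extension, block corners and background data as the torus `Q(U)` typed there)

statement-level skeleton of published theorems with citation tags; proofs where landed; nothing here is a claim about the Yang–Mills mass gap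

PDF held: `paper:balaban1985-cmp102-variational-background` (journal page = PDF page + 276); p. 285 read on the render
`pub-balaban/b2b-balaban-ref1/pages/1985-cmp102-variational-background/1985-cmp102-variational-background-p009-x2.png` (AS AN IMAGE, this seat,
2026-08-21); [4] = `paper:balaban1985-cmp98-averaging` pp. 36, 43 through the verbatim quotations of `B7Prop3GeneralLinear` / `B7Prop7OneStep`.

THE PRINT (verbatim, p. 285): *«The Proposition 4 of [4] implies Q_j(ηA) = LʲηQ_jA + C_j(LʲηA), |C_j(LʲηA)| ≦ C₂(Lʲη)²|A|². (44) … We will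
construct the linearizing transformation in the form A = A′ − HD(A′), (47) where D will be a mapping defined on configurations A and with
values in configurations on 𝔅_k. This mapping has to satisfy the equations Q_j(ηA) = Q_j(ηA′ − ηHD(A′)) = LʲηQ_jA′ − LʲηQ_jHD(A′) +
C_j(LʲηA′ − LʲηHD(A′)) = LʲηQ_jA′ on Λ_j, (48) or C_j(LʲηA′ − LʲηHD(A′)) = D(A′) on Λ_j. (49) Thus the function D(A′) is a fixed point of the
transformation X → C_j(LʲηA′ − LʲηHX) on Λ_j, j = 0, 1, …, k. (50) We consider configurations A′, X with values in the complexified Lie algebra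
gᶜ, and satisfying |A′| < ε₃(Lʲη)⁻¹ on Ω_j, X = 0 on Λ₀, |X| < ε₃/B₀ on 𝔅_k. (51) The transformation (50) calculated at such configurations
satisfies |C_j(LʲηA′ − LʲηHX)| ≦ C₂(Lʲη|A′| + Lʲη|HX|)² < 4C₂ε₃², (52)»*.  [4] p. 36 (122)–(123): *«Q(V₀, A, c) = L(Q(V₀)A)_c + C(V₀, A, c).
(122) C(V₀, A, c) is an analytic function of A whose Taylor's expansion begins with a second-order polynomial (a quadratic form), and
|C(V₀, A, c)| ≦ C₁L²|A|² < C₁(Lα₁)². (123)»*; p. 43 Proposition 7: *«the function Q_k(U′U₀, ηA) is analytic in complex variables A′, A, and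
Proposition 4 holds uniformly in A′.»*

WHY THIS FILE (cell context).  INTERFACE REQUEST NE9 letter (L5): the Sect. C map `C` between the NE9 row owner's carriers
(`B11Eq115Space.Space115 L η lev₀ lev₁ ∇ → NegSize L η levB 0 V`) = the `quad` slot of lit-balaban's Sect. C `B11Eq174Chart.Regime H 0 C b 0 C₂ c₄ 0 a_C ε_C`
and the letter `hCa` of `Summits/…/NE9B11ChartAnalytic.chart47_spec` (consumed through the `T`-slot of `B11Eq103H1Complex.chartOfLetters`); requested by the
NE9 refuter («type (L5) `Cc` at the carrier as a `Regime` slot», PRICING-NE9 v20).  The owner's `B9Eq315QTorus` (E162) typed the LINEAR one-step `Q(U)` on the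
torus by reading [4]'s `ℤ^d` objects on the periodic extension; THIS FILE types its NONLINEAR companion `C` of (44) in the same model and DISCHARGES both
analytic clauses from the NE7c crew's [4] theorems — no bound of the paper is a hypothesis here.

DICTIONARY / MODEL READINGS (those of `B9Eq315QTorus`, (M1)–(M3) there).  (M1) torus `TSite d (L·m)` (fine bonds `Bond d (fineP L m)`), coarse
torus `TSite d m` (bonds `Bond d m` = print's 𝔅 at ONE level), periodic extension `perCfg` to the [4] carriers `Site d = ℤ^d`, the block of the
coarse site `y` has corner `cornerSite L y = L·y`.  (M2) the background `U : Bond d (fineP L m) → 𝔸ˣ` with DISPLAYED structural data: unit-bounded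
extension (`hU1`) and `α`-regular block loops (`hreg`, `α ≤ 1/128` — the threshold of `B7Prop7OneStep`; E162 uses `1/64`).  (M3) ONE level: print's
`j` is `1` on every fine bond (`hlev : 1 ≤ lev₀`: every bond of Ω₁ = T_η is averaged once; (51)'s «X = 0 on Λ₀» is void), so `Lʲη = Lη` and the
weight `(Lη)¹` of `|·|_{(−1)}` turns [4]'s `C₁L²·(sup|ηY|)²` into `C₂‖Y‖²_{(115)}`.  (M4) [4]'s field variable carries the `η` (tree dictionary of
`B7Prop3GeneralLinear`: «η, i absorbed»): print's `C₁(LηY)` IS [4]'s `C(U, ηY, c)` (from (44) with `j = 1` against (122): `Q₁(ηY) = Q(U, ηY, c)`,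
`LηQ₁Y = L(Q(U)(ηY))_c`), hence the `η •` in `Cblock`.  (M5) fibre `𝔸` = any complete normed `ℂ`-algebra with `‖1‖ = 1` (the NE7c carriers; print: gᶜ ⊂
matrices), `V := 𝔸` in the carriers.

WHAT IS DEFINED AND PROVED (sorry-free; no `Prop` placeholder; no inequality of the paper asserted — (123) and Prop. 7 are the NE7c crew's
THEOREMS `B7Prop7OneStep.norm_Ccov_cplx_le_explicit` / `Qcov_cplx_analyticAt_field`, instantiated).
* §1 **`Cblock L m η U A c`** := `B7Prop3GeneralLinear.Ccov L (perCfg U) (perCfg (η • A)) (cornerSite L y) κ` at the coarse bond `c = (y, κ)` — print's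
  `C₁(LηA)` at `c`; `Cblock_zero`; **`eq44`** — (44) «Q₁(ηA) = LηQ₁A + C₁(LηA)» VERBATIM with `Q₁ := B9Eq315QTorus.QtorusAt …` (the owner's torus
  `Q(U)`): `Qcov … (perCfg (η•A)) (cornerSite L y) κ = (L·η) • QtorusAt … y κ A + Cblock … A (y, κ)` (`linQcov_perCfg_smul`: the linear part of the
  extension of `η•A` is `(Lη) •` the owner's normalised `Q(U)A`).
* §2 **`norm_Cblock_le`** — (123)/(44) at a coarse bond: `η·sup‖A‖ ≤ a ≤ c₃(d,L)/4 ⇒ ‖Cblock A c‖ ≤ 2097152(d+1)²L²·a²` (`B7Prop7OneStep.norm_Ccov_cplx_le_explicit`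
  at the unit perturbation `U″ = 1`); **`analyticAt_Cblock`** — Prop. 7's analyticity clause at a coarse bond, Fréchet in `A` on the finite-dimensional
  torus configuration space, for `η·sup‖A‖ < 1/(512(d+1)L)` (`Qcov_cplx_analyticAt_field` in family form + linearity of the linear part, E156/E162).
* §3 **`Cc L m η U lev₀ lev₁ ∇ levB : Space115 L η lev₀ lev₁ ∇ → NegSize L η levB 0 𝔸`** := `B11Eq44QuadLetter.quadOf … (Cblock L m η U)` — THE LETTER (L5)
  (`∇`, `lev₁`, `levB` arbitrary: the bound reads only the `|·|_{(−1)}` part); `equiv_Cc_apply` (rfl), `Cc_zero`.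
* §4 **`quadAnalytic_Cc : QuadAnalytic (Cc …) (2097152·(d+1)²) (1/(512·(d+1)))`**, **`analyticOnNhd_Cc`** (on `{‖Y‖ < 1/(512(d+1))}`), `prop4Hyp_Cc`,
  `norm_Cc_le_sq` — under `1 ≤ L`, (M2), `hlev : ∀ b, 1 ≤ lev₀ b`: the `quad` FIELD of the Sect. C `Regime` and `chart47_spec`'s `hCa` BY NAME, with
  `C₂ = 2097152(d+1)²` (d-only, as print's «C₂»; = NE7c's `16·C₁` in (115)-currency), `c₄ = 1/(512(d+1))`; `quadAnalytic_Cc_one` (NON-VACUITY at `U ≡ 1`).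
* §5 **`regime_sectC`** — lit-balaban's Sect. C `Regime (HopAd … U kH) 0 (Cc …) b 0 C₂ c₄ 0 a_C ε_C` ASSEMBLED from the typed letters (L4) `H` (its bound
  from the two row-sum letters of its kernel, `B11Eq45HOperator.norm_HopAd_le`) and (L5) `C` (its `quad` clause from §4): what remains displayed is
  `0 ≤ b`, the row sums `≤ b`, and the three NUMERICAL conditions `dom`/`self`/`contr` (the (L7) arithmetic; print Prop. 3 p. 289).
HONEST SCOPE.  Assembly + instantiation; the estimates are the NE7c crew's.  NOT typed here (named): the composite `C_j` for `k` levels (multi-level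
`lev₀ = levOf Ω k`; [4] Prop. 4/5, `B7Prop5GeneralInduction.CCovIter`, `B11Eq44Concrete` for the `insCfg`/sup-norm reading), complex backgrounds
`U″V₀` (allowed by `B7Prop7OneStep`; sequel on request), the (L7) arithmetic itself («18C₂B₀dc₁(½)ε₃ ≤ 1, 2ε₃ ≤ c₄»), (L8).  NOT summit progress
(cell pub-balaban: NE9 NOT PRINTED / NOT PROVED, «NE9 ⇐ the named binders»; spine PROVED 0/9; rung (B)+1 on a finite T⁴ — NOT infinite volume, NOT
mass gap, NOT Clay).  Filed by the pub-balaban NE9 crux-team leaf seat `b2b-balaban-t4-ne9-formalise-leaf-03` (gen 54); NEW file; imports E162,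
`B7Prop7OneStep`, `B11Eq45HOperator`, `B11Eq44QuadLetter`; nothing modified.  Net new unproved facts: 0.
-/

noncomputable section

namespace Literature.MathematicalPhysics.QuantumFieldTheory.Balaban1983to89.B11Eq44COperatorTorus

open Metric Set B11Eq115Space B11Eq44QuadLetter
open B13Contraction113 (QuadAnalytic)
open B11Prop6Scheme (Prop4Hyp)
open B9Eq315QTorus (perSite perCfg perCfgLin cornerSite QtorusAt perCfg_apply QtorusAt_apply)
open B9Eq319QprimeTorus (fineP)
open B9SectCLatticeCarrier (Bond)   open B4Sect5Torus (TSite)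
open B7Prop1Explicit (U1 Wcx boxVec)
open B7Prop3Flat (c3 c3_pos)
open B7Prop3GeneralLinear (Qcov linQcov Ccov Qcov_eq_linQcov_add_Ccov Qcov_zero)
open B7Eq122LinearPartIsLinear (linQAt linQAt_apply)
open B7Prop7OneStep (norm_Ccov_cplx_le_explicit Qcov_cplx_analyticAt_field)

variable {d : ℕ} {𝔸 : Type*} [NormedRing 𝔸] [NormedAlgebra ℂ 𝔸] [CompleteSpace 𝔸] (L : ℕ) (m : Fin d → ℕ) [∀ i, NeZero (fineP L m i)]
  (η : ℝ) (U : Bond d (fineP L m) → 𝔸ˣ)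

/-! ## §1 The block map `C₁(Lη ·)` at a coarse bond and the identity (44) against the owner's `Q(U)` -/

/-- **Print's `C₁(LηA)` at the coarse bond `c = (y, κ)` of the torus** — [4] (122)'s remainder `C(Ũ, ηÃ, ⟨L·y, L·y + Le_κ⟩)` = `Q − (its linear part)`
(NE7c's `B7Prop3GeneralLinear.Ccov`) of the periodic extensions `Ũ = perCfg U`, `Ã = perCfg A` at the block corner `L·y` (readings (M1), (M4)).
[cite: Balaban1985Variational, (44) p.285, (50) p.285; Balaban1985Averaging, (122) p.36] -/
def Cblock (A : Bond d (fineP L m) → 𝔸) (c : Bond d m) : 𝔸 :=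
  Ccov L (perCfg (fineP L m) U) (perCfg (fineP L m) ((η : ℂ) • A)) (cornerSite L c.1) c.2

/-- Unfolding. [cite: Balaban1985Variational, (44) p.285] -/
theorem Cblock_apply (A : Bond d (fineP L m) → 𝔸) (c : Bond d m) :
    Cblock L m η U A c = Ccov L (perCfg (fineP L m) U) (perCfg (fineP L m) ((η : ℂ) • A)) (cornerSite L c.1) c.2 := rfl

omit [CompleteSpace 𝔸] in
/-- The periodic extension commutes with scalars (it is linear: `perCfgLin`). [cite: Balaban1985Averaging, (1) p.17] -/
theorem perCfg_smul (t : ℂ) (A : Bond d (fineP L m) → 𝔸) : perCfg (fineP L m) (t • A) = t • perCfg (fineP L m) A := rfl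

/-- `C₁` has no constant term: `Cblock 0 = 0` (`Q(Ũ, 0, c) = 0`, linear part of `0` is `0`). [cite: Balaban1985Variational, (55) p.286] -/
theorem Cblock_zero : Cblock L m η U 0 = 0 := by
  funext c; rw [Cblock_apply, smul_zero, Pi.zero_apply, Ccov]
  have h0 : perCfg (fineP L m) (0 : Bond d (fineP L m) → 𝔸) = 0 := rfl
  have hlin : linQcov L (perCfg (fineP L m) U) (0 : B7Prop1Explicit.Site d → Fin d → 𝔸) (cornerSite L c.1) c.2 = 0 := by
    simp only [linQcov, smul_zero, Qcov_zero, deriv_const]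
  rw [h0, Qcov_zero, hlin, sub_zero]

section Linear

variable [NormOneClass 𝔸] (hL : 1 ≤ L) {α : ℝ} (hα1 : α ≤ 1 / 64)
  (hU1 : ∀ (x : B7Prop1Explicit.Site d) (κ : Fin d), perCfg (fineP L m) U x κ ∈ U1 𝔸)
  (hreg : ∀ (y : TSite d m) (κ : Fin d) (r : Fin d → Fin L),
    ‖((Wcx L (perCfg (fineP L m) U) (cornerSite L y) κ (boxVec L r) : 𝔸ˣ) : 𝔸) - 1‖ ≤ α)

/-- **The linear part of the extension of `η•A` is `(L·η) •` the owner's normalised `Q(U)A`** (E156's `linQAt` IS linear; E162's `QtorusAt = L⁻¹ • linQcov`):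
`L(Q(Ũ)(ηÃ))_c = (Lη)·(Q(U)A)_c` — print's «LʲηQ_jA» at `j = 1`. [cite: Balaban1985Variational, (44) p.285; Balaban1985Averaging, (122) p.36] -/
theorem linQcov_perCfg_smul (A : Bond d (fineP L m) → 𝔸) (y : TSite d m) (κ : Fin d) :
    linQcov L (perCfg (fineP L m) U) (perCfg (fineP L m) ((η : ℂ) • A)) (cornerSite L y) κ =
      ((L : ℂ) * η) • QtorusAt L m hL U hα1 hU1 hreg y κ A := by
  have hL0 : (L : ℂ) ≠ 0 := by exact_mod_cast (show (L : ℕ) ≠ 0 by omega)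
  have hlin : linQcov L (perCfg (fineP L m) U) (perCfg (fineP L m) ((η : ℂ) • A)) (cornerSite L y) κ =
      (η : ℂ) • linQcov L (perCfg (fineP L m) U) (perCfg (fineP L m) A) (cornerSite L y) κ := by
    rw [perCfg_smul, ← linQAt_apply hL hU1 (cornerSite L y) κ hα1 (hreg y κ), map_smul, linQAt_apply]
  rw [hlin, QtorusAt_apply, smul_smul, show ((L : ℂ) * (η : ℂ)) * ((L : ℂ))⁻¹ = (η : ℂ) by field_simp]

/-- **(44) VERBATIM at one level, against the owner's torus `Q(U)`**: «Q₁(ηA) = LηQ₁A + C₁(LηA)» — the one-step average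
`Q(Ũ, ηÃ, c)` of [4] (121) at the block corner IS `(Lη)·(Q(U)A)(c) + Cblock A c`. [cite: Balaban1985Variational, (44) p.285; Balaban1985Averaging, (121)–(122) p.36] -/
theorem eq44 (A : Bond d (fineP L m) → 𝔸) (y : TSite d m) (κ : Fin d) :
    Qcov L (perCfg (fineP L m) U) (perCfg (fineP L m) ((η : ℂ) • A)) (cornerSite L y) κ =
      ((L : ℂ) * η) • QtorusAt L m hL U hα1 hU1 hreg y κ A + Cblock L m η U A (y, κ) := by
  rw [Cblock_apply, Qcov_eq_linQcov_add_Ccov, linQcov_perCfg_smul L m η U hL hα1 hU1 hreg]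

/-- The block map split along (44): `Cblock A (y, κ) = Q(Ũ, ηÃ, c) − (Lη)·(Q(U)A)(c)`. [cite: Balaban1985Variational, (44) p.285] -/
theorem Cblock_eq_sub (A : Bond d (fineP L m) → 𝔸) (y : TSite d m) (κ : Fin d) :
    Cblock L m η U A (y, κ) =
      Qcov L (perCfg (fineP L m) U) (perCfg (fineP L m) ((η : ℂ) • A)) (cornerSite L y) κ -
        ((L : ℂ) * η) • QtorusAt L m hL U hα1 hU1 hreg y κ A := by
  rw [eq44 L m η U hL hα1 hU1 hreg, add_sub_cancel_left]
end Linear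

/-! ## §2 The NE7c crew's (123) and Prop. 7 at a coarse bond of the torus -/

section Pointwise

variable [NormOneClass 𝔸] (hL : 1 ≤ L) {α : ℝ} (hα : α ≤ 1 / 128) (hη : 0 ≤ η)
  (hU1 : ∀ (x : B7Prop1Explicit.Site d) (κ : Fin d), perCfg (fineP L m) U x κ ∈ U1 𝔸)
  (hreg : ∀ (y : TSite d m) (κ : Fin d) (r : Fin d → Fin L),
    ‖((Wcx L (perCfg (fineP L m) U) (cornerSite L y) κ (boxVec L r) : 𝔸ˣ) : 𝔸) - 1‖ ≤ α)

include hη in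
omit [CompleteSpace 𝔸] [NormOneClass 𝔸] in
/-- The extension of `η • A` is bounded by `η·sup‖A‖` (`0 ≤ η`). [cite: Balaban1985Averaging, (1) p.17] -/
theorem norm_perCfg_smul_le (A : Bond d (fineP L m) → 𝔸) {a : ℝ} (hA : ∀ b, η * ‖A b‖ ≤ a) (x : B7Prop1Explicit.Site d) (κ : Fin d) :
    ‖perCfg (fineP L m) ((η : ℂ) • A) x κ‖ ≤ a := by
  rw [perCfg_apply, Pi.smul_apply, norm_smul, Complex.norm_real, Real.norm_of_nonneg hη]
  exact hA _

include hL hα hη hU1 hreg in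
/-- **(123)/(44) AT A COARSE BOND** («|C(V₀, A, c)| ≦ C₁L²|A|²», NE7c's `B7Prop7OneStep.norm_Ccov_cplx_le_explicit` at the unit perturbation `U″ = 1`):
`η·sup‖A‖ ≤ a ≤ c₃(d,L)/4 ⇒ ‖Cblock A c‖ ≤ 2097152(d+1)²L²·a²`. [cite: Balaban1985Variational, (44) p.285, (52) p.285; Balaban1985Averaging, (123) p.36, Proposition 7 p.43] -/
theorem norm_Cblock_le (A : Bond d (fineP L m) → 𝔸) {a : ℝ} (ha : 0 ≤ a) (hA : ∀ b, η * ‖A b‖ ≤ a) (hac : a ≤ c3 d L / 4)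
    (c : Bond d m) : ‖Cblock L m η U A c‖ ≤ 2097152 * ((d : ℝ) + 1) ^ 2 * (L : ℝ) ^ 2 * a ^ 2 := by
  have hUone : ∀ (x : B7Prop1Explicit.Site d) (κ : Fin d),
      ‖(((1 : B7Prop1Explicit.Site d → Fin d → 𝔸ˣ) x κ : 𝔸ˣ) : 𝔸) - 1‖ ≤ 0 ∧
        ‖((((1 : B7Prop1Explicit.Site d → Fin d → 𝔸ˣ) x κ)⁻¹ : 𝔸ˣ) : 𝔸) - 1‖ ≤ 0 := fun x κ => by simp
  have hun : ((2 * (d * L) + L + L : ℕ) : ℝ) * 0 ≤ 1 / 512 := by norm_num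
  have h := norm_Ccov_cplx_le_explicit hL hU1 le_rfl hUone hun (perCfg (fineP L m) ((η : ℂ) • A)) ha
    (norm_perCfg_smul_le L m η hη A hA) hac (cornerSite L c.1) c.2 hα (hreg c.1 c.2)
  rwa [one_mul] at h

include hL hα hη hU1 hreg in
/-- **PROPOSITION 7's ANALYTICITY CLAUSE AT A COARSE BOND, FRÉCHET IN THE TORUS CONFIGURATION**: for `η·sup‖A‖ < 1/(512(d+1)L)` the block value
`A ↦ Cblock A c` is analytic at `A` on the finite-dimensional space of torus configurations — `Q` by NE7c's `Qcov_cplx_analyticAt_field` in family form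
(family `A ↦ perCfg (η•A)`, unit perturbation), the linear part by its linearity (E156 `linQAt`, E162 `QtorusAt`; finite dimension).
[cite: Balaban1985Averaging, Proposition 7 p.43, Proposition 3 (121)–(122) p.36; Balaban1985Variational, (44) p.285, p.286] -/
theorem analyticAt_Cblock [FiniteDimensional ℂ 𝔸] (A : Bond d (fineP L m) → 𝔸)
    (hA : ∀ b, η * ‖A b‖ < 1 / (512 * ((d : ℝ) + 1) * L)) (c : Bond d m) :
    AnalyticAt ℂ (fun A' : Bond d (fineP L m) → 𝔸 => Cblock L m η U A' c) A := by
  have hL0 : (0 : ℝ) < L := by exact_mod_cast hL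
  have hα1 : α ≤ 1 / 64 := hα.trans (by norm_num)
  -- the `Q` part, in family form
  have hUone : ∀ (x : B7Prop1Explicit.Site d) (κ : Fin d),
      ‖(((1 : B7Prop1Explicit.Site d → Fin d → 𝔸ˣ) x κ : 𝔸ˣ) : 𝔸) - 1‖ ≤ 0 ∧
        ‖((((1 : B7Prop1Explicit.Site d → Fin d → 𝔸ˣ) x κ)⁻¹ : 𝔸ˣ) : 𝔸) - 1‖ ≤ 0 := fun x κ => by simp
  have hB : ∀ (x : B7Prop1Explicit.Site d) (κ : Fin d),
      AnalyticAt ℂ (fun A' : Bond d (fineP L m) → 𝔸 => perCfg (fineP L m) ((η : ℂ) • A') x κ) A := fun x κ => by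
    simp only [perCfg_apply, Pi.smul_apply]
    exact (analyticAt_const : AnalyticAt ℂ (fun _ : Bond d (fineP L m) → 𝔸 => (η : ℂ)) A).smul
      ((ContinuousLinearMap.proj (R := ℂ) (φ := fun _ : Bond d (fineP L m) => 𝔸) (perSite (fineP L m) x, κ)).analyticAt A)
  have ha0 : (0 : ℝ) ≤ 1 / (512 * ((d : ℝ) + 1) * L) := by positivity
  have hθ : ((2 * (d * L) + L + L : ℕ) : ℝ) * (1 / (512 * ((d : ℝ) + 1) * L) + 2 * 0) ≤ 1 / 128 := by
    have hcast : ((2 * (d * L) + L + L : ℕ) : ℝ) = 2 * ((d : ℝ) + 1) * L := by push_cast; ring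
    rw [hcast, mul_zero, add_zero]
    have hpos : (0 : ℝ) < ((d : ℝ) + 1) * L := by positivity
    rw [show 2 * ((d : ℝ) + 1) * L * (1 / (512 * ((d : ℝ) + 1) * L)) = 1 / 256 by field_simp; ring]
    norm_num
  have hQ := Qcov_cplx_analyticAt_field (fun A' : Bond d (fineP L m) → 𝔸 => perCfg (fineP L m) ((η : ℂ) • A')) hB hL hU1
    le_rfl hUone ha0 (fun x κ => norm_perCfg_smul_le L m η hη A (fun b => (hA b).le) x κ) hθ (by norm_num) le_rfl
    (cornerSite L c.1) c.2 hα (hreg c.1 c.2)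
  simp only [one_mul] at hQ
  -- the linear part: a linear map on a finite-dimensional space
  have hlin : AnalyticAt ℂ (fun A' : Bond d (fineP L m) → 𝔸 => ((L : ℂ) * η) • QtorusAt L m hL U hα1 hU1 hreg c.1 c.2 A') A :=
    (LinearMap.toContinuousLinearMap (((L : ℂ) * η) • QtorusAt L m hL U hα1 hU1 hreg c.1 c.2)).analyticAt A
  have heq : (fun A' : Bond d (fineP L m) → 𝔸 => Cblock L m η U A' c) = fun A' =>
      Qcov L (perCfg (fineP L m) U) (perCfg (fineP L m) ((η : ℂ) • A')) (cornerSite L c.1) c.2 -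
        ((L : ℂ) * η) • QtorusAt L m hL U hα1 hU1 hreg c.1 c.2 A' := by
    funext A'
    exact Cblock_eq_sub L m η U hL hα1 hU1 hreg A' c.1 c.2
  rw [heq]
  exact hQ.sub hlin
end Pointwise

/-! ## §3 The letter (L5): `C` between the carriers of (115) -/

section Letter

variable {κ' : Type*} (lev₀ : Bond d (fineP L m) → ℕ) (lev₁ : κ' → ℕ) (Dc : (Bond d (fineP L m) → 𝔸) →ₗ[ℂ] (κ' → 𝔸))
  (levB : Bond d m → ℕ)

/-- **THE LETTER `C` OF (44)/(49)–(50) AT THE CARRIER** — `Y ↦ C₁(LηY)` from the space (115) of the fine torus (index `Bond d (fineP L m)`, any `∇`,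
any level maps) to the block-field size space `|·|_{(−0)}` of the coarse torus (index `Bond d m` = 𝔅): `B11Eq44QuadLetter.quadOf` of `Cblock`.  This is
the `C` of the Sect. C regime `B11Eq174Chart.Regime H 0 C b 0 C₂ c₄ 0 a_C ε_C` / of `NE9B11ChartAnalytic.chart47_spec`. [cite: Balaban1985Variational, (44) p.285, (47)–(50) p.285] -/
def Cc : Space115 (L : ℝ) η lev₀ lev₁ Dc → NegSize (L : ℝ) η levB 0 𝔸 :=
  quadOf (levWeight (L : ℝ) η lev₀ 1) (levWeight (L : ℝ) η lev₁ 2) Dc (levWeight (L : ℝ) η levB 0) (Cblock L m η U)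

/-- Its values are the block values (by `rfl`). [cite: Balaban1985Variational, (44) p.285] -/
@[simp] theorem equiv_Cc_apply (Y : Space115 (L : ℝ) η lev₀ lev₁ Dc) (c : Bond d m) :
    NegSup.equiv _ 𝔸 (Cc L m η U lev₀ lev₁ Dc levB Y) c = Cblock L m η U (JetSup.equiv _ _ Dc Y) c := rfl

/-- `C(0) = 0`. [cite: Balaban1985Variational, (55) p.286] -/
theorem Cc_zero : Cc L m η U lev₀ lev₁ Dc levB 0 = 0 :=
  quadOf_zero (levWeight (L : ℝ) η lev₀ 1) (levWeight (L : ℝ) η lev₁ 2) Dc (levWeight (L : ℝ) η levB 0) (Cblock_zero L m η U)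
end Letter

/-! ## §4 The `quad` slot and the analyticity letter, PROVED -/

section Regime

variable [NormOneClass 𝔸] {κ' : Type*} (lev₀ : Bond d (fineP L m) → ℕ) (lev₁ : κ' → ℕ)
  (Dc : (Bond d (fineP L m) → 𝔸) →ₗ[ℂ] (κ' → 𝔸)) (levB : Bond d m → ℕ) [Fact (0 < η)]
  (hL : 1 ≤ L) {α : ℝ} (hα : α ≤ 1 / 128)
  (hU1 : ∀ (x : B7Prop1Explicit.Site d) (κ : Fin d), perCfg (fineP L m) U x κ ∈ U1 𝔸)
  (hreg : ∀ (y : TSite d m) (κ : Fin d) (r : Fin d → Fin L),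
    ‖((Wcx L (perCfg (fineP L m) U) (cornerSite L y) κ (boxVec L r) : 𝔸ˣ) : 𝔸) - 1‖ ≤ α)
  (hlev : ∀ b, 1 ≤ lev₀ b)

include hlev in
omit [NormedAlgebra ℂ 𝔸] [CompleteSpace 𝔸] [NormOneClass 𝔸] [∀ i, NeZero (fineP L m i)] [Fact (0 < η)] in
/-- Reading (M3): with `1 ≤ lev₀` and `1 ≤ L`, the pointwise datum `(L^{j(b)}η)·‖f(b)‖ ≤ r` of `|·|_{(−1)}` gives `η·‖f(b)‖ ≤ r/L`.
[cite: Balaban1985Variational, (51) p.285, p.286] -/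
theorem eta_mul_norm_le_of_weight (hL1 : (1 : ℝ) ≤ L) (hη : 0 ≤ η) (f : Bond d (fineP L m) → 𝔸) {r : ℝ}
    (hf : ∀ b, levWeight (L : ℝ) η lev₀ 1 b * ‖f b‖ ≤ r) (b : Bond d (fineP L m)) : η * ‖f b‖ ≤ r / L := by
  have hL0 : (0 : ℝ) < L := lt_of_lt_of_le one_pos hL1
  rw [le_div_iff₀ hL0]
  have hw : (L : ℝ) * η ≤ levWeight (L : ℝ) η lev₀ 1 b := by
    rw [levWeight_apply, pow_one]
    exact mul_le_mul_of_nonneg_right (by simpa using pow_le_pow_right₀ hL1 (hlev b)) hη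
  calc η * ‖f b‖ * L = (L * η) * ‖f b‖ := by ring
    _ ≤ levWeight (L : ℝ) η lev₀ 1 b * ‖f b‖ := mul_le_mul_of_nonneg_right hw (norm_nonneg _)
    _ ≤ r := hf b

include hL hα hU1 hreg hlev in
/-- **THE LOCAL WEIGHTED QUADRATIC BOUND of `Cblock` in (115)-currency**: pointwise `|·|_{(−1)}`-data `≤ r < 1/(512(d+1))` ⟹ every block value
`≤ 2097152(d+1)²·r²` (the `L²` of (123) against the `(Lη)²` of the weight — print's «|C_j(LʲηA)| ≦ C₂(Lʲη)²|A|²» read as `≤ C₂|A|²_{(−1)}`).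
[cite: Balaban1985Variational, (44) p.285, (52) p.285, (55) p.286; Balaban1985Averaging, (123) p.36] -/
theorem localQuad_Cblock (f : Bond d (fineP L m) → 𝔸) (r : ℝ) (hr : 0 ≤ r) (hrc : r < 1 / (512 * ((d : ℝ) + 1)))
    (hf : ∀ b, levWeight (L : ℝ) η lev₀ 1 b * ‖f b‖ ≤ r) (_hDf : ∀ p, levWeight (L : ℝ) η lev₁ 2 p * ‖Dc f p‖ ≤ r) (c : Bond d m) :
    levWeight (L : ℝ) η levB 0 c * ‖Cblock L m η U f c‖ ≤ 2097152 * ((d : ℝ) + 1) ^ 2 * r ^ 2 := by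
  have hL1 : (1 : ℝ) ≤ L := by exact_mod_cast hL
  have hL0 : (0 : ℝ) < L := lt_of_lt_of_le one_pos hL1
  have hη : 0 ≤ η := (Fact.out : 0 < η).le
  have ha : ∀ b, η * ‖f b‖ ≤ r / L := eta_mul_norm_le_of_weight L m η lev₀ hlev hL1 hη f hf
  have hac : r / L ≤ c3 d L / 4 := by
    rw [c3, div_le_iff₀ hL0]
    have hpos : (0 : ℝ) < 128 * ((d : ℝ) + 1) * L := by positivity
    have h1 : 1 / (128 * ((d : ℝ) + 1) * L) / 4 * L = 1 / (512 * ((d : ℝ) + 1)) := by field_simp; ring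
    rw [h1]; exact hrc.le
  have h := norm_Cblock_le L m η U hL hα hη hU1 hreg f (by positivity) ha hac c
  rw [levWeight_apply, pow_zero, one_mul]
  refine h.trans (le_of_eq ?_)
  field_simp

include hL hα hU1 hreg hlev in
/-- **Prop. 7's clause in (115)-currency**: at every flat point whose `|·|_{(−1)}`-data are `< 1/(512(d+1))` every block value is analytic.
[cite: Balaban1985Averaging, Proposition 7 p.43; Balaban1985Variational, (44) p.285, p.286] -/
theorem localAnalytic_Cblock [FiniteDimensional ℂ 𝔸] (f : Bond d (fineP L m) → 𝔸)
    (hf : ∀ b, levWeight (L : ℝ) η lev₀ 1 b * ‖f b‖ < 1 / (512 * ((d : ℝ) + 1)))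
    (_hDf : ∀ p, levWeight (L : ℝ) η lev₁ 2 p * ‖Dc f p‖ < 1 / (512 * ((d : ℝ) + 1))) (c : Bond d m) :
    AnalyticAt ℂ (fun g : Bond d (fineP L m) → 𝔸 => Cblock L m η U g c) f := by
  have hL1 : (1 : ℝ) ≤ L := by exact_mod_cast hL
  have hL0 : (0 : ℝ) < L := lt_of_lt_of_le one_pos hL1
  have hη : 0 ≤ η := (Fact.out : 0 < η).le
  refine analyticAt_Cblock L m η U hL hα hη hU1 hreg f (fun b => ?_) c
  -- strict pointwise: `η‖f b‖·L ≤ (L^{lev₀ b}η)‖f b‖ < c₄`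
  have hw : (L : ℝ) * η ≤ levWeight (L : ℝ) η lev₀ 1 b := by
    rw [levWeight_apply, pow_one]
    exact mul_le_mul_of_nonneg_right (by simpa using pow_le_pow_right₀ hL1 (hlev b)) hη
  rw [lt_div_iff₀ (by positivity)]
  calc η * ‖f b‖ * (512 * ((d : ℝ) + 1) * L) = ((L : ℝ) * η * ‖f b‖) * (512 * ((d : ℝ) + 1)) := by ring
    _ ≤ (levWeight (L : ℝ) η lev₀ 1 b * ‖f b‖) * (512 * ((d : ℝ) + 1)) :=
        mul_le_mul_of_nonneg_right (mul_le_mul_of_nonneg_right hw (norm_nonneg _)) (by positivity)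
    _ < 1 / (512 * ((d : ℝ) + 1)) * (512 * ((d : ℝ) + 1)) := mul_lt_mul_of_pos_right (hf b) (by positivity)
    _ = 1 := by field_simp

variable [Fintype κ'] [Fact (0 < (L : ℝ))]

include hL hα hU1 hreg hlev in
/-- **(44)/(52) FOR THE LETTER**: `‖Y‖_{(115)} < 1/(512(d+1)) ⇒ ‖C(Y)‖_{(−0)} ≤ 2097152(d+1)²·‖Y‖²` («|C_j(LʲηA′ …)| ≦ C₂(…)²»).
[cite: Balaban1985Variational, (44) p.285, (52) p.285] -/
theorem norm_Cc_le_sq {Y : Space115 (L : ℝ) η lev₀ lev₁ Dc} (hY : ‖Y‖ < 1 / (512 * ((d : ℝ) + 1))) :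
    ‖Cc L m η U lev₀ lev₁ Dc levB Y‖ ≤ 2097152 * ((d : ℝ) + 1) ^ 2 * ‖Y‖ ^ 2 :=
  norm_quadOf_le_sq (levWeight (L : ℝ) η lev₀ 1) (levWeight (L : ℝ) η lev₁ 2) Dc (levWeight (L : ℝ) η levB 0) (F := Cblock L m η U) (by positivity)
    (localQuad_Cblock L m η U lev₀ lev₁ Dc levB hL hα hU1 hreg hlev) hY

include hL hα hU1 hreg hlev in
/-- **THE ANALYTICITY LETTER `hCa` OF `chart47_spec`** for `C`: analytic on `{‖Y‖_{(115)} < 1/(512(d+1))}` («an analytic function of A», p. 286;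
[4] Prop. 7). [cite: Balaban1985Variational, p.286, (47) p.285; Balaban1985Averaging, Proposition 7 p.43] -/
theorem analyticOnNhd_Cc [FiniteDimensional ℂ 𝔸] :
    AnalyticOnNhd ℂ (Cc L m η U lev₀ lev₁ Dc levB) {Y : Space115 (L : ℝ) η lev₀ lev₁ Dc | ‖Y‖ < 1 / (512 * ((d : ℝ) + 1))} :=
  analyticOnNhd_quadOf (levWeight (L : ℝ) η lev₀ 1) (levWeight (L : ℝ) η lev₁ 2) Dc (levWeight (L : ℝ) η levB 0) (F := Cblock L m η U)
    (localAnalytic_Cblock L m η U lev₀ lev₁ Dc hL hα hU1 hreg hlev)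

include hL hα hU1 hreg hlev in
/-- **`Prop4Hyp` of the letter `C`** (lit-balaban's Fréchet form: quadratic bound + `DifferentiableOn ℂ` on the ball).
[cite: Balaban1985Variational, (44) p.285, Prop. 4 (97)–(98) pp.292–293] -/
theorem prop4Hyp_Cc [FiniteDimensional ℂ 𝔸] :
    Prop4Hyp (Cc L m η U lev₀ lev₁ Dc levB) (2097152 * ((d : ℝ) + 1) ^ 2) (1 / (512 * ((d : ℝ) + 1))) :=
  prop4Hyp_quadOf (levWeight (L : ℝ) η lev₀ 1) (levWeight (L : ℝ) η lev₁ 2) Dc (levWeight (L : ℝ) η levB 0) (F := Cblock L m η U) (by positivity)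
    (localQuad_Cblock L m η U lev₀ lev₁ Dc levB hL hα hU1 hreg hlev) (localAnalytic_Cblock L m η U lev₀ lev₁ Dc hL hα hU1 hreg hlev)

include hL hα hU1 hreg hlev in
/-- **THE `quad` SLOT OF THE SECT. C REGIME FOR THE LETTER (L5)**: `QuadAnalytic C C₂ c₄` with `C₂ = 2097152(d+1)²` and `c₄ = 1/(512(d+1))` —
(44)'s two clauses («|C_j(LʲηA)| ≦ C₂(Lʲη)²|A|²» and [4] Prop. 7's analyticity) PROVED for the typed `C`, ready for
`B11Eq174Chart.Regime H 0 (Cc …) b 0 C₂ c₄ 0 a_C ε_C` / `NE9B11ChartAnalytic.chart47_spec`. [cite: Balaban1985Variational, (44) p.285, (49)–(52) p.285, Prop. 3 p.289] -/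
theorem quadAnalytic_Cc [FiniteDimensional ℂ 𝔸] :
    QuadAnalytic (Cc L m η U lev₀ lev₁ Dc levB) (2097152 * ((d : ℝ) + 1) ^ 2) (1 / (512 * ((d : ℝ) + 1))) :=
  (prop4Hyp_Cc L m η U lev₀ lev₁ Dc levB hL hα hU1 hreg hlev).quadAnalytic
include hL hlev in
/-- **NON-VACUITY — the flat background `U ≡ 1`** meets (M2) with `α = 0` (`B7Eq122LinearPartIsLinear.one_mem_U1` / `flat_regular`): the letter `C` of
the FLAT one-step averaging has its `quad` clause with no displayed hypothesis beyond `1 ≤ L`, `1 ≤ lev₀`. [cite: Balaban1985Variational, (44) p.285] -/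
theorem quadAnalytic_Cc_one [FiniteDimensional ℂ 𝔸] :
    QuadAnalytic (Cc L m η (1 : Bond d (fineP L m) → 𝔸ˣ) lev₀ lev₁ Dc levB) (2097152 * ((d : ℝ) + 1) ^ 2) (1 / (512 * ((d : ℝ) + 1))) :=
  quadAnalytic_Cc L m η 1 lev₀ lev₁ Dc levB hL (α := 0) (by norm_num) (fun x κ => B7Eq122LinearPartIsLinear.one_mem_U1 x κ)
    (fun y κ r => B7Eq122LinearPartIsLinear.flat_regular (cornerSite L y) κ r) hlev
end Regime

/-! ## §5 The Sect. C regime of the typed letters `H` (`B11Eq45HOperator.HopAd`) and `C` (`Cc`): no `quad` hypothesis left -/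

section SectC

open B11Eq45HOperator (HopAd norm_HopAd_le gradKernel)   open B11Eq115KernelOp (rowSum)   open B11Eq174Chart (Regime)
open B11Eq111FrakG (nabla115)   open B9Eq33CovDerivVector (adTransport)

variable [NormOneClass 𝔸] [FiniteDimensional ℂ 𝔸] (lev₀ : Bond d (fineP L m) → ℕ) (lev₁ : Bond d (fineP L m) × Fin d → ℕ)
  (levB : Bond d m → ℕ) [Fact (0 < (L : ℝ))] [Fact (0 < η)]
  (hL : 1 ≤ L) {α : ℝ} (hα : α ≤ 1 / 128)
  (hU1 : ∀ (x : B7Prop1Explicit.Site d) (κ : Fin d), perCfg (fineP L m) U x κ ∈ U1 𝔸)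
  (hreg : ∀ (y : TSite d m) (κ : Fin d) (r : Fin d → Fin L),
    ‖((Wcx L (perCfg (fineP L m) U) (cornerSite L y) κ (boxVec L r) : 𝔸ˣ) : 𝔸) - 1‖ ≤ α)
  (hlev : ∀ b, 1 ≤ lev₀ b)

include hL hα hU1 hreg hlev in
/-- **THE SECT. C REGIME OF THE TYPED LETTERS** (print Prop. 3 p. 289: «for … ε₃ sufficiently small, e.g. 18C₂B₀dc₁(½)ε₃ ≤ 1, 2ε₃ ≤ c₄»; lit-balaban's
`B11Eq174Chart.Regime H 0 C b 0 C₂ c₄ 0 a_C ε_C` = the hypotheses of the (50)/(116)-type contraction): with `H := HopAd … U₀ kH` ((L4), its (46)-bound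
from the two ROW-SUM letters of its kernel) and `C := Cc …` ((L5), ITS `quad` CLAUSE PROVED here), the regime holds given `0 ≤ b`, the two row-sum
letters `≤ b`, and the three NUMERICAL conditions `dom`/`self`/`contr` of the scheme on `b`, `C₂ = 2097152(d+1)²`, `c₄ = 1/(512(d+1))`, `a_C`, `ε_C`
(the (L7) arithmetic, displayed).  Feeds `NE9B11ChartAnalytic.chart47_spec` / `chartHB_triple_of_twoRegimes` together with `analyticOnNhd_Cc`.
[cite: Balaban1985Variational, Prop. 3 p.289, (45)–(52) p.285, (54) p.286] -/
theorem regime_sectC (kH : Bond d (fineP L m) → Bond d m → (𝔸 →L[ℂ] 𝔸)) {b aC εC : ℝ} (hb : 0 ≤ b)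
    (h₀ : ∀ x, rowSum (levWeight (L : ℝ) η levB 0) (levWeight (L : ℝ) η lev₀ 1) kH x ≤ b)
    (h₁ : ∀ p, rowSum (levWeight (L : ℝ) η levB 0) (levWeight (L : ℝ) η lev₁ 2) (gradKernel ((η : ℂ)⁻¹) (adTransport U) kH) p ≤ b)
    (hε : 0 ≤ εC) (hdom : 2 * (εC + aC) ≤ 1 / (512 * ((d : ℝ) + 1)))
    (hself : b * (2097152 * ((d : ℝ) + 1) ^ 2) * (εC + aC) ^ 2 ≤ εC)
    (hcontr : 4 * b * (2097152 * ((d : ℝ) + 1) ^ 2) * (εC + aC) < 1) :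
    Regime (HopAd (L : ℝ) η levB lev₀ lev₁ U kH) 0 (Cc L m η U lev₀ lev₁ (nabla115 η U) levB) b 0
      (2097152 * ((d : ℝ) + 1) ^ 2) (1 / (512 * ((d : ℝ) + 1))) 0 aC εC where
  norm_G := norm_HopAd_le (L : ℝ) η levB lev₀ lev₁ U hb h₀ h₁
  norm_L := fun Y => by simp
  quad := quadAnalytic_Cc L m η U lev₀ lev₁ (nabla115 η U) levB hL hα hU1 hreg hlev
  B₀_nonneg := hb
  C₄_nonneg := by positivity
  θ_nonneg := le_rfl
  ε₄_nonneg := hε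
  dom := hdom
  self := by simpa using hself
  contr := by simpa using hcontr
end SectC

end Literature.MathematicalPhysics.QuantumFieldTheory.Balaban1983to89.B11Eq44COperatorTorus

end
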